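import Mathlib
import Summits.Ventures.HodgeRepro.Tier4.Common.MixedPlane

/-!
# Tier4/Line4/NotSquareOfConjNe — the CM condition gives `¬ IsSquare (−n)` (the `hd` binder of OrbitInvariantFibre)

Blind re-derivation cell `pub-hodge-repro`, Tier 4 «prove the step» (README §9–§10), seat t4-L1-p3 (gen 4).
Tree path `lean/Summits/Ventures/HodgeRepro/Tier4/Line4/NotSquareOfConjNe.lean`.

`DescribesCM q` (the skeleton's display, unpacked as binders exactly as typer-2's IsCMAtOfConj does) gives `ω ∈ E` with
`ω² = t ω − n` and `c(ω) ≠ ω`.  At `t = 0`: if `−n = s²` with `s ∈ k = E⁺` then `ω = ±s ∈ E⁺`, fixed by the complex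
conjugation (`IsCMField.complexConj_apply_eq_self`) — against `c(ω) ≠ ω`.  So `¬ IsSquare (−q.n)`: the `hd` binder of
OrbitFibre / OrbitInvariantFibre (crit-2 S15294's instance obligation).  No printed input.
HC_CM is NOT proved by anyone in this repository.
-/

namespace Summit.Ventures.HodgeRepro.Tier4.Line4

open NumberField Summit.Ventures.HodgeRepro.Tier4.Common

variable {E : Type} [Field E] [NumberField E] [IsCMField E]

/-- **`−n` is not a square in `E⁺` when `X² + n` has a root moved by the complex conjugation** (`t = 0`). -/
theorem not_isSquare_neg_of_conj_ne (q : QuadData (↥(maximalRealSubfield E))) (ω : E)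
    (hω : ω ^ 2 = algebraMap (↥(maximalRealSubfield E)) E q.t * ω - algebraMap (↥(maximalRealSubfield E)) E q.n)
    (hne : IsCMField.complexConj E ω ≠ ω) (ht : q.t = 0) : ¬ IsSquare (-q.n) := by
  rintro ⟨s, hs⟩
  have h1 : ω ^ 2 = (algebraMap (↥(maximalRealSubfield E)) E s) ^ 2 := by
    rw [hω, ht, map_zero, zero_mul, zero_sub, ← map_neg, hs, map_mul, sq]
  rcases sq_eq_sq_iff_eq_or_eq_neg.mp h1 with h | h
  · apply hne
    rw [h]
    exact IsCMField.complexConj_apply_eq_self E s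
  · apply hne
    rw [h, map_neg]
    exact congrArg Neg.neg (IsCMField.complexConj_apply_eq_self E s)

end Summit.Ventures.HodgeRepro.Tier4.Line4
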